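import Summits.HubbardSuperconductivity.HubbardSuperconductivity.Theses.IsoperimetricCascade
import Literature.MathematicalPhysics.QuantumLattice.ApproximateEigenvectorLemmas

/-!
# Birth skeleton (BC3) for crux `OverlapRate` — stmt-HubbardSuperconductivity-11981
(route `IsoperimetricCascade`, rank 3; sub-problem `HubbardSuperconductivity`)

Planner `planner-skel-stmt-HubbardSuperconductivity-11981-0`, 2026-08-17 (skeleton-register, re-audit bin
REPAIRABLE). Published as `Cruxes/OverlapRate/Lines/birth.lean`.

The crux (card K2 of `isoperimetric-pair-cascade`): for every `(U, δ) ∈ [2,8] × [1/10, 2/5]` there are a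
spectator number `r`, a rate `γ` and `L₀` such that for all even `L ≥ L₀` EVERY normalised
`(2K, S^z = 0)`-sector ground state `ψ` of `hubbardTorus 2 L 1 U` (`K = ⌊(1-δ)L²/2⌋`) has
`e^{-γL²} ‖(Δᴴ)^n |0⟩‖² ≤ μ_n(ψ) := ‖Δ^n ψ‖²`, `n = K - r`, `Δ = pairField dWaveFormFactor L` — the weight of
`ψ` along the flat `d`-wave AGP direction (with `r` spectator pairs) is not SUPER-exponentially small.

The skeleton cuts the crux along the one selection rule that is known to be load-bearing (refuters
g43-10, g44-40, g44-9, rreview-0815T18-15 on item 11981; kernel-checked in tree as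
`Summit.HubbardSuperconductivity.NoGo.spinSq_commute_pairField` +
`Summit.HubbardSuperconductivity.NoGo.eq_zero_of_isNParticle_of_spinSq_mulVec`): `Δ` is a spin SINGLET,
so `Δ^{K-r} ψ` is a `2r`-particle vector with the total spin of `ψ`, hence `0` whenever `S(ψ) > r`.
"Every ground state" therefore hides a UNIFORM SPIN BOUND, and the overlap content proper is a statement
about spin-resolved ground states. Three stubs — REDUCTION × SPIN BOUND × SPIN-RESOLVED OVERLAP:

* `stub_spinEigenReduction : SpinEigenReduction` — REDUCTION TO SPIN MULTIPLETS (provable now, size M):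
  for any form factor `g`, side `L`, couplings `t, U`, sector `(N, M)`, depth `n` and constant `c`, if
  every normalised sector ground state that is an `S²`-eigenvector (`spinSq ψ = λψ`, `λ : ℝ`) has
  `c ≤ ‖Δ_g^n ψ‖²`, then every normalised sector ground state has. Proof sketch: `S²` is Hermitian
  (`HubbardWave0.spinZ_isHermitian`, `spinMinus = spinPlusᴴ`), commutes with `H`
  (`LiebThm1.hamiltonian_commute_spinPlus/Minus`, `hamiltonian_isHermitian_and_commute_holds`) and is
  block-diagonal in the `(N, S^z)` sectors (`NoGo.preservesSectors_spinSq`), so the sector ground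
  eigenspace `V` is `S²`-invariant and `ψ = Σ_λ ψ_λ` with `ψ_λ ∈ V` pairwise orthogonal `S²`-eigenvectors;
  `Δ_g` commutes with `S²` (`NoGo.spinSq_commute_pairField`), so the `Δ_g^n ψ_λ` lie in distinct
  `S²`-eigenspaces and `‖Δ_g^n ψ‖² = Σ_λ ‖Δ_g^n ψ_λ‖² ≥ c Σ_λ ‖ψ_λ‖² = c` (for `c ≥ 0`; trivial otherwise).
* `stub_groundStateSpinBound : GroundStateSpinBound` — BOUNDED GROUND-STATE SPIN ON THE WINDOW (open):
  for every `(U, δ)` in the window there are `s, L₀` with: for all even `L ≥ L₀`, every `(2K, 0)`-sector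
  ground state that is an `S²`-eigenvector has eigenvalue `≤ s(s+1)`. The hidden necessary condition of
  the crux made explicit (crux ∧ `FlatAGPNormGrowth` ⟹ it with `s = r`, by the selection rule above);
  strictly weaker than the crux (no overlap content). No theorem bounds the ground-state spin of the
  doped repulsive Hubbard model uniformly in `L` (Lieb 1989 is half filling / `U < 0`; Nagaoka-type
  polarisation is route NoGo's crux `NogoNagaokaWindow`, expected only for `U ≫ 8`). Where it would fail:
  unbounded (not necessarily saturated) ground-state spin somewhere in `[2,8] × [1/10, 2/5]`.
* `stub_spinResolvedReferenceOverlap : SpinResolvedReferenceOverlap` — THE SPIN-RESOLVED REFERENCE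
  OVERLAP (the hard core, XL; load-bearing): for every `(U, δ)` in the window and every spin bound `s`
  there are `r, γ, L₀` such that for all even `L ≥ L₀` every normalised `(2K, 0)`-sector ground state
  `ψ` with `spinSq ψ = λψ`, `λ ≤ s(s+1)`, admits a UNIT SPECTATOR VECTOR `χ` with
  `e^{-γL²} ‖(Δᴴ)^n |0⟩‖² ≤ |⟨(Δᴴ)^n χ, ψ⟩|²` (`n = K - r`): the flat AGP dressed with `χ`'s `2r` particles
  overlaps `ψ` at a merely exponential rate. This is the crux's own reading "`μ_{K-r}` = sup over unit
  `2r`-particle `χ` of `|⟨(Δᴴ)^{K-r} χ, ψ⟩|²`" restricted to spin-resolved ground states, where the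
  spectator construction is well posed (`r ≥ S` is available because `r` may depend on `s`); it is the
  form a prover attacks (card P4: Jensen split through one sign-matched reference AGP; d-BCS heuristic:
  all overlap terms `ĝ_d(k) v_k/u_k ≥ 0`, `γ_PBCS ∈ [0.55, 1.21]`, ED `γ_d ≈ 0.6–0.7` on `4 × 4`).
  Where it would fail: destructive interference making the node-avoiding fully-paired component of a
  repulsive ground state smaller than any `e^{-γL²}` (at `U = 0` it is EXACTLY `0` for `r < #`nodal pairs
  `≈ 0.9 L` — outside the window, and `O(L) ≪ L²` modes, but it shows the claim is non-perturbative in `U`).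

Composition `OverlapRate_of` (hypotheses spelled `__Registered.stub_X`, `rfl`-aliases keyed by the stub
names, for the native audit `#h21_check_skeleton`) is proved below WITHOUT `sorry`: fix `(U, δ)`; take
`s, L₁` from the spin bound and `r, γ, L₂` from the spin-resolved overlap at that `s`; `L₀ := max L₁ L₂`;
for even `L ≥ L₀` apply the reduction with `c := e^{-γL²} ‖(Δᴴ)^n |0⟩‖²`, whose hypothesis holds for every
`S²`-eigenvector ground state `φ` by the spin bound, the overlap stub and Cauchy–Schwarz against the unit
spectator: `|⟨(Δᴴ)^n χ, φ⟩|² = |⟨χ, Δ^n φ⟩|² ≤ ‖Δ^n φ‖²` (`star_mulVec`, `dotProduct_mulVec`,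
`conjTranspose_pow`, `norm_star_dotProduct_le_eucNorm`, `eucNorm_sq`). It concludes the route decl
`Summit.HubbardSuperconductivity.HubbardSuperconductivity.Theses.IsoperimetricCascade.OverlapRate` BY NAME.
Sorries live only in the three `stub_*` theorems. Logical shape: given the tree theorems
(`flatAGPNormGrowth_proof`, the selection rule, and stub R once proved) the crux is EQUIVALENT to
`GroundStateSpinBound ∧ SpinResolvedReferenceOverlap`; each conjunct is strictly weaker than the crux.

Disproof used: none relevant — `ledger crux ls stmt-HubbardSuperconductivity-11981` lists no workfiles
(no `Cruxes/OverlapRate/Disproof.lean`, no `_false_without_` theorem, no landed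
`Theorems/OverlapRate/Negative/*`), and `ledger negatives --problem HubbardSuperconductivity` (2 entries:
CooperPairDMottWalk breathing self-duality, AposterioriCapRg KLS openness) touches none of the stubs
(2026-08-17). Refuter notes honoured: the spin selection rule is the seam (stub A is exactly the flagged
hidden hypothesis; stub B assumes only what A delivers); the window `[2,8] × [1/10, 2/5]` and the
normalisation / sector conventions of the crux are kept verbatim in A and B.

BC3 audit (planner folder `bc/`, 2026-08-17, farm `lean check --json`): this file rc 0, errors [],
sorries 3 = the three `stub_*` theorems (the only `declaration uses sorry` warnings),
`#print axioms OverlapRate_of` = [propext, Classical.choice, Quot.sound] (no `sorryAx`). Probes (files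
`bc/probe_<Stub>_<crux|summit>.lean`: route file + the stub def only, 6 examples each = {combined
`first | exact? | simpa [S] | (unfold S; simpa) | simpa | aesop`, `exact?`, `simpa [S]`, `(unfold S; simpa)`,
`simpa`, `aesop`} for each target `S → OverlapRate`, `S → _root_.HubbardSuperconductivity`, each under
`maxHeartbeats 400000`): for every stub statement `S ∈ {SpinEigenReduction, GroundStateSpinBound,
SpinResolvedReferenceOverlap}` ALL examples FAIL (rc 1; `exact?`: "could not close the goal", `simpa`
variants: "Tactic `assumption` failed", `aesop`: "failed to prove the goal after exhaustive search",
combined: "unsolved goals") — 36/36 probes fail: no stub is cheaply the crux or the summit.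
-/

-- the mandated namespace repeats `HubbardSuperconductivity` (single-problem summit, D-0017)
set_option linter.dupNamespace false

noncomputable section

namespace Summit.HubbardSuperconductivity.HubbardSuperconductivity.Cruxes.OverlapRate.Birth

open scoped BigOperators Topology Classical Matrix ComplexConjugate
open Matrix Literature.Probability.LatticeModels Literature.MathematicalPhysics.QuantumLattice

/-! ## Stub statements -/

/-- **Stub R — reduction to spin multiplets (provable now, size M).** On the fermionic torus of side
`L`, for the Hubbard Hamiltonian `hubbardTorus 2 L t U`, any sector `(N, S^z = M)`, any pair form
factor `g`, any depth `n` and any constant `c`: if every normalised sector ground state `ψ` that is an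
`S²`-eigenvector (`spinSq ψ = λ ψ`, `λ : ℝ`) satisfies `c ≤ ‖Δ_g^n ψ‖²`, then EVERY normalised sector
ground state does. Reason: `S²` is Hermitian, commutes with `H`, `N̂`, `S^z`, so the sector ground
eigenspace splits into `S²`-eigenspaces; `Δ_g` is a spin singlet (`spinSq_commute_pairField`), so the
pieces `Δ_g^n ψ_λ` stay in distinct (orthogonal) `S²`-eigenspaces and `‖Δ_g^n ψ‖² = Σ_λ ‖Δ_g^n ψ_λ‖²`. -/
def SpinEigenReduction : Prop :=
  ∀ (g : Site 2 → ℝ) (L : ℕ) [NeZero L] (t U : ℝ) (N : ℕ) (M : ℝ) (n : ℕ) (c : ℝ),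
    (∀ ψ : Fock (Orb (FermionTorus 2 L)), star ψ ⬝ᵥ ψ = 1 →
        IsGroundStateInSector (hubbardTorus 2 L t U) N M ψ →
          ∀ lam : ℝ, spinSq *ᵥ ψ = (lam : ℂ) • ψ →
            c ≤ (star (pairField g L ^ n *ᵥ ψ) ⬝ᵥ (pairField g L ^ n *ᵥ ψ)).re) →
      ∀ ψ : Fock (Orb (FermionTorus 2 L)), star ψ ⬝ᵥ ψ = 1 →
        IsGroundStateInSector (hubbardTorus 2 L t U) N M ψ →
          c ≤ (star (pairField g L ^ n *ᵥ ψ) ⬝ᵥ (pairField g L ^ n *ᵥ ψ)).re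

/-- **Stub A — bounded ground-state spin on the window (open).** For every `(U, δ) ∈ [2,8] × [1/10,2/5]`
there are `s` and `L₀` such that for all even `L ≥ L₀` every `(2K, S^z = 0)`-sector ground state `ψ`
of `hubbardTorus 2 L 1 U` (`K = ⌊(1-δ)L²/2⌋`) that is an `S²`-eigenvector has eigenvalue `≤ s(s+1)`
(total spin `≤ s`, uniformly in `L`). The hidden necessary condition of the crux made explicit
(refuters g43-10 / rreview-0815: `Δ_d` is a singlet, so `Δ_d^{K-r} ψ = 0` whenever `S(ψ) > r`). -/
def GroundStateSpinBound : Prop :=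
  ∀ U ∈ Set.Icc (2:ℝ) 8, ∀ δ ∈ Set.Icc (1/10:ℝ) (2/5), ∃ s : ℕ, ∃ L₀ : ℕ, ∀ (L : ℕ) [NeZero L],
    L₀ ≤ L → Even L → ∀ ψ : Fock (Orb (FermionTorus 2 L)),
      IsGroundStateInSector (hubbardTorus 2 L 1 U) (2 * ⌊(1 - δ) * (L : ℝ) ^ 2 / 2⌋₊) 0 ψ →
        ∀ lam : ℝ, spinSq *ᵥ ψ = (lam : ℂ) • ψ → lam ≤ (s : ℝ) * ((s : ℝ) + 1)

/-- **Stub B — spin-resolved reference overlap (the hard core, XL).** For every `(U, δ)` in the window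
and every spin bound `s` there are a spectator number `r`, a rate `γ` and `L₀` such that for all even
`L ≥ L₀` every normalised `(2K, 0)`-sector ground state `ψ` that is an `S²`-eigenvector with eigenvalue
`≤ s(s+1)` admits a unit "spectator" vector `χ` whose dressed flat `d`-wave AGP `(Δᴴ)^n χ`
(`n = K - r`, `Δ = pairField dWaveFormFactor L`) overlaps `ψ` at a merely exponential rate:
`e^{-γL²} ‖(Δᴴ)^n |0⟩‖² ≤ |⟨(Δᴴ)^n χ, ψ⟩|²`. -/
def SpinResolvedReferenceOverlap : Prop :=
  ∀ U ∈ Set.Icc (2:ℝ) 8, ∀ δ ∈ Set.Icc (1/10:ℝ) (2/5), ∀ s : ℕ, ∃ r : ℕ, ∃ γ : ℝ, ∃ L₀ : ℕ,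
    ∀ (L : ℕ) [NeZero L], L₀ ≤ L → Even L → ∀ ψ : Fock (Orb (FermionTorus 2 L)), star ψ ⬝ᵥ ψ = 1 →
      IsGroundStateInSector (hubbardTorus 2 L 1 U) (2 * ⌊(1 - δ) * (L : ℝ) ^ 2 / 2⌋₊) 0 ψ →
        ∀ lam : ℝ, spinSq *ᵥ ψ = (lam : ℂ) • ψ → lam ≤ (s : ℝ) * ((s : ℝ) + 1) →
          let Δ := pairField dWaveFormFactor L
          let n := ⌊(1 - δ) * (L : ℝ) ^ 2 / 2⌋₊ - r
          let Φ := Δᴴ ^ n *ᵥ vacuum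
          ∃ χ : Fock (Orb (FermionTorus 2 L)), star χ ⬝ᵥ χ = 1 ∧
            Real.exp (-(γ * (L : ℝ) ^ 2)) * (star Φ ⬝ᵥ Φ).re ≤ ‖star (Δᴴ ^ n *ᵥ χ) ⬝ᵥ ψ‖ ^ 2

/-! ## Registered stubs -/

/-- stub R: reduction to `S²`-eigenvector ground states (provable now). -/
theorem stub_spinEigenReduction : SpinEigenReduction := by
  sorry

/-- stub A: bounded ground-state spin on the window (open). -/
theorem stub_groundStateSpinBound : GroundStateSpinBound := by
  sorry

/-- stub B: spin-resolved reference overlap (hardest stub; open). -/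
theorem stub_spinResolvedReferenceOverlap : SpinResolvedReferenceOverlap := by
  sorry

/-! ## Name-keyed aliases of the stub statements — the hypotheses of `OverlapRate_of` -/
namespace __Registered

/-- Alias of `SpinEigenReduction` keyed by the registered stub name. -/
abbrev stub_spinEigenReduction : Prop := SpinEigenReduction
/-- Alias of `GroundStateSpinBound` keyed by the registered stub name. -/
abbrev stub_groundStateSpinBound : Prop := GroundStateSpinBound
/-- Alias of `SpinResolvedReferenceOverlap` keyed by the registered stub name. -/
abbrev stub_spinResolvedReferenceOverlap : Prop := SpinResolvedReferenceOverlap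

end __Registered

/-! ## Composition: the crux BY NAME from the three stub statements (no `sorry` below) -/

/-- **OverlapRate_of** — spin bound (A) ⟹ the spin-resolved reference overlap (B) applies to every
`S²`-eigenvector ground state; Cauchy–Schwarz `|⟨(Δᴴ)^n χ, ψ⟩|² = |⟨χ, Δ^n ψ⟩|² ≤ ‖Δ^n ψ‖²` turns it into
the cascade moment bound for those; the multiplet reduction (R) extends it to EVERY ground state. -/
theorem OverlapRate_of (hR : __Registered.stub_spinEigenReduction)
    (hA : __Registered.stub_groundStateSpinBound)
    (hB : __Registered.stub_spinResolvedReferenceOverlap) :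
    Summit.HubbardSuperconductivity.HubbardSuperconductivity.Theses.IsoperimetricCascade.OverlapRate := by
  dsimp only [__Registered.stub_spinEigenReduction, SpinEigenReduction] at hR
  dsimp only [__Registered.stub_groundStateSpinBound, GroundStateSpinBound] at hA
  dsimp only [__Registered.stub_spinResolvedReferenceOverlap, SpinResolvedReferenceOverlap] at hB
  dsimp only [Summit.HubbardSuperconductivity.HubbardSuperconductivity.Theses.IsoperimetricCascade.OverlapRate]
  intro U hU δ hδ
  obtain ⟨s, L₁, hA'⟩ := hA U hU δ hδ
  obtain ⟨r, γ, L₂, hB'⟩ := hB U hU δ hδ s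
  refine ⟨r, γ, max L₁ L₂, ?_⟩
  intro L _ hL hEv ψ hψ1 hGS
  -- reduce to `S²`-eigenvector ground states (stub R) with the constant `c := e^{-γL²} ‖Φ‖²`
  refine hR dWaveFormFactor L 1 U (2 * ⌊(1 - δ) * (L : ℝ) ^ 2 / 2⌋₊) 0
    (⌊(1 - δ) * (L : ℝ) ^ 2 / 2⌋₊ - r) _ ?_ ψ hψ1 hGS
  intro φ hφ1 hφGS lam hlam
  -- the spin bound (stub A) feeds the spin-resolved overlap (stub B)
  have hspin : lam ≤ (s : ℝ) * ((s : ℝ) + 1) := hA' L (le_of_max_le_left hL) hEv φ hφGS lam hlam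
  obtain ⟨χ, hχ1, hχ⟩ := hB' L (le_of_max_le_right hL) hEv φ hφ1 hφGS lam hlam hspin
  -- Cauchy–Schwarz against the unit spectator vector `χ`
  have hmove : star ((pairField dWaveFormFactor L)ᴴ ^ (⌊(1 - δ) * (L : ℝ) ^ 2 / 2⌋₊ - r) *ᵥ χ) ⬝ᵥ φ =
      star χ ⬝ᵥ (pairField dWaveFormFactor L ^ (⌊(1 - δ) * (L : ℝ) ^ 2 / 2⌋₊ - r) *ᵥ φ) := by
    rw [star_mulVec, ← dotProduct_mulVec, conjTranspose_pow, conjTranspose_conjTranspose]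
  have hCS := norm_star_dotProduct_le_eucNorm hχ1
    (pairField dWaveFormFactor L ^ (⌊(1 - δ) * (L : ℝ) ^ 2 / 2⌋₊ - r) *ᵥ φ)
  calc Real.exp (-(γ * (L : ℝ) ^ 2)) *
        (star ((pairField dWaveFormFactor L)ᴴ ^ (⌊(1 - δ) * (L : ℝ) ^ 2 / 2⌋₊ - r) *ᵥ vacuum) ⬝ᵥ
          ((pairField dWaveFormFactor L)ᴴ ^ (⌊(1 - δ) * (L : ℝ) ^ 2 / 2⌋₊ - r) *ᵥ vacuum)).re
      ≤ ‖star ((pairField dWaveFormFactor L)ᴴ ^ (⌊(1 - δ) * (L : ℝ) ^ 2 / 2⌋₊ - r) *ᵥ χ) ⬝ᵥ φ‖ ^ 2 := hχ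
    _ = ‖star χ ⬝ᵥ (pairField dWaveFormFactor L ^ (⌊(1 - δ) * (L : ℝ) ^ 2 / 2⌋₊ - r) *ᵥ φ)‖ ^ 2 := by
        rw [hmove]
    _ ≤ eucNorm (pairField dWaveFormFactor L ^ (⌊(1 - δ) * (L : ℝ) ^ 2 / 2⌋₊ - r) *ᵥ φ) ^ 2 :=
        pow_le_pow_left₀ (norm_nonneg _) hCS 2
    _ = (star (pairField dWaveFormFactor L ^ (⌊(1 - δ) * (L : ℝ) ^ 2 / 2⌋₊ - r) *ᵥ φ) ⬝ᵥ
          (pairField dWaveFormFactor L ^ (⌊(1 - δ) * (L : ℝ) ^ 2 / 2⌋₊ - r) *ᵥ φ)).re := eucNorm_sq _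

end Summit.HubbardSuperconductivity.HubbardSuperconductivity.Cruxes.OverlapRate.Birth
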